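/-
Copyright (c) 2026. All rights reserved.
Released under Apache 2.0 license as described in the file LICENSE.
-/
import Literature.AlgebraicGeometry.ComplexMultiplication.HyperellipticJacobianOddCompositeDivisorDegenerate
import Literature.AlgebraicGeometry.ComplexMultiplication.HyperellipticJacobianLevelForty
import Literature.AlgebraicGeometry.Pohlmann1968.CMFamilyRankSubfamilies
import Literature.AlgebraicGeometry.Pohlmann1968.SimpleCMAbelianFourfoldPowers
import Literature.AlgebraicGeometry.Milne1999.SimpleIsogenyFactorsUniqueness
import HarnessLib

/-!
# Which Jacobians `J_m = J(y² = x^m − 1)` are stably nondegenerate: the classification `m ∈ {p, 2p, 2^k, 3, 4, 6, 8, 12, 24, 20}`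

Layer `Literature/AlgebraicGeometry/ComplexMultiplication`, namespace `…ComplexMultiplication.HyperellipticJacobian`; the capstone of
`HyperellipticJacobianStablyNondegenerateLevels` (F35, the positive list), `HyperellipticJacobianFourTimesPrimeLevelDegenerate` (F36, `4p ∣ m`) and
`HyperellipticJacobianOddCompositeDivisorDegenerate` (F37, odd composite divisors).  THEOREMS ONLY (no definition, no named fact, no `sorry`, no instance).

THE PRINT.  Gallese–Goodson–Lombardo [GalleseGoodsonLombardo2024] §1 (p. 4: «in most cases the Hodge ring of `J_m` contains exceptional Hodge cycles»; the
Theorem: `J_m` nondegenerate for `m` an odd prime or `4`; p. 5: «the largest `m` for which `J_m` is isogenous to a product of elliptic curves is `24`»),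
§3 Thm. 3.0 (the decomposition `J_m ∼ ∏_{d ∣ m, d ≠ 1,2} X_d` and the structure of the `X_d`), §3.4 (`X_{20}, X_{24}, X_{60}`), §4.1 Prop. 19 (`rank MT`);
Gordon [Gordon1999HodgeAVSurvey] 7.4–7.6.1 (stable nondegeneracy; Hazama's remarks: products ∕ factors; `rank = rdim + 1`); Goodson
[Goodson2024DegeneracyFermat] Thm. 1.1 (odd composite `m`).  The CLASSIFICATION below is ASSEMBLED from these and the tree's rank formula
`rank MT(J_m) = 1 + φ(m)/2` (`cmFamilyRank_eq_one_add_totient_div_two_of_conductorLevels`); it is not printed as one statement in the sources.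

WHAT IS PROVED (a family `C_j ⊨ (ℚ(ζ_{e_j}); Ψ_j)` of realisations of the lower-half types with exactly one member at each divisor `e ≥ 3` of `m` —
Thm. 3.0 read as hypothesis; «`J_m`» = `⨁_j C_j` and everything isogenous to it).
* §1 **THE DIMENSION-COUNT CRITERION** `not_isStablyNondegenerate_biproduct_of_totient_div_two_lt_sum`: if some members `C_{v t}` (distinct) have all their
  simple isogeny factors of dimensions `d_t`, members with EQUAL `d_t` being orthogonal (`Hom = 0`), and `Σ_t d_t > φ(m)/2`, then `J_m` is NOT stably
  nondegenerate — the sub-biproduct is a retract (F37 §1), Gordon 7.5 (1) ⟺ (3) for the descended separating family (tree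
  `isStablyNondegenerate_biproduct_iff_cmFamilyRank_eq_sum_dim_inducedCMType`), and `rank(sub-family) ≤ rank MT(J_m) = 1 + φ(m)/2` (`cmFamilyRank_comp_le`).
* §2 **`J_{40}`** (members `4, 8, 20, 5, 40`: simple factors of dimensions `1, 1, 1, 2, 4`, `Σ = 9 > 8 = φ(40)/2`; `X_4 ⟂ Y_8 ⟂ Y_{20} ⟂ X_4`) and
  **`J_{48}`** (members `3, 4, 8, 16, 48`: `1, 1, 1, 2, 4`, `Σ = 9 > 8`; `X_3 ⟂ X_4 ⟂ Y_8 ⟂ X_3`) are NOT stably nondegenerate; hence `J_m` for every `m`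
  with `40 ∣ m` or `48 ∣ m` (the `J_{40}`- ∕ `J_{48}`-sub-family is a retract).
* §3 **THE CLASSIFICATION** `isStablyNondegenerate_iff_of_isIsogenous_biproduct`: for `m ≥ 3` and `X ∼ ⨁_j C_j`,
  `X` is stably nondegenerate ⟺ `m` is an odd prime, or `m = 2p` (`p` an odd prime), or `m = 2^k` (`k ≥ 2`), or `m ∣ 24`, or `m = 20`
  (⟸: F35, on all powers; ⟹: every other `m ≥ 3` has an odd composite divisor, or `4p ∣ m` with `p ≥ 7`, or `40 ∣ m`, or `48 ∣ m` — F37, F36, §2).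

HONEST REGISTER.  «Not stably nondegenerate» = some power carries a rational `(q,q)`-class outside the span of products of divisor classes (power and
codimension not located); NOTHING is claimed about the algebraicity of such classes — for the `m` outside the list the Hodge conjecture for `J_m` is
neither advanced nor refuted here; for the `m` in the list F35 gives `𝓑 = 𝓓` and the Hodge conjecture on all powers.  «`J_m`» is the abstract biproduct
over the divisor-indexed family, not a curve-theoretic Jacobian.
-/

noncomputable section

open CategoryTheory CategoryTheory.Limits NumberField Module

namespace Literature.AlgebraicGeometry.ComplexMultiplication

open Literature.AlgebraicGeometry.Motives
open Literature.AlgebraicGeometry.Motives.AbelianVariety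
open Literature.AlgebraicGeometry.Milne1999
open Literature.AlgebraicGeometry.HodgeTheory (complexBetti HodgeConjectureFor IsRationalClass IsOfHodgeType IsStablyNondegenerate
  IsDivisorGenerated)
open Literature.AlgebraicGeometry.VanGeemen1994 (hodgeClassSpan)
open Literature.Barriers.HodgeConjecture (divisorClassesSpan)
open Literature.NumberTheory.ComplexMultiplication

namespace HyperellipticJacobian

open Literature.AlgebraicGeometry.Pohlmann1968 Literature.AlgebraicGeometry.Pohlmann1968.Cyclotomic
open Literature.AlgebraicGeometry.Pohlmann1968.CMAlgebra

/-! ## §0 Fixed-level wrappers (the tree's level-`4 ∕ 8 ∕ 20` statements at a propositionally fixed level) -/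

section Wrappers

variable {N : ℕ} [NeZero N] {K : Type} [Field K] [NumberField K] [IsCyclotomicExtension {N} ℚ K] {Φ : CMType K}
  {A : AbelianVariety ℂ} {ι : 𝓞 K →+* End A} {θ : K →+* Module.End ℂ (complexBetti A.X 1)}
  {N' : ℕ} [NeZero N'] {K' : Type} [Field K'] [NumberField K'] [IsCyclotomicExtension {N'} ℚ K'] {Φ' : CMType K'}
  {A' : AbelianVariety ℂ} {ι' : 𝓞 K' →+* End A'} {θ' : K' →+* Module.End ℂ (complexBetti A'.X 1)}

/-- `X_4 ⟂ Y_{d'}` for `8 ∣ d'`, `d' ≠ 24`, at a level propositionally equal to `4`. [folklore] -/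
private theorem orth_four_of_eight_dvd (hN : N = 4) (hA : IsCMTypeRealisation Φ A ι θ) (h8 : 8 ∣ N') (h24 : N' ≠ 24)
    (hΦ' : ∀ σ : K' →+* ℂ, σ ∈ Φ'.1 ↔ 2 * (expOf N' K' σ).val < N') (hA' : IsCMTypeRealisation Φ' A' ι' θ') :
    (∀ u : A ⟶ A', u = 0) ∧ ∀ u : A' ⟶ A, u = 0 := by
  subst hN
  obtain ⟨h₁, h₂, -, -⟩ := orthogonal_four_fourDvd_of_eight_dvd hA h8 h24 hΦ' hA'
  exact ⟨h₁, h₂⟩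

/-- `X_4 ⟂ Y_{20}` at levels propositionally equal to `4` and `20`. [folklore] -/
private theorem orth_four_twenty (hN : N = 4) (hN' : N' = 20) (hA : IsCMTypeRealisation Φ A ι θ)
    (hΦ' : ∀ σ : K' →+* ℂ, σ ∈ Φ'.1 ↔ 2 * (expOf N' K' σ).val < N') (hA' : IsCMTypeRealisation Φ' A' ι' θ') :
    (∀ u : A ⟶ A', u = 0) ∧ ∀ u : A' ⟶ A, u = 0 := by
  subst hN hN'
  obtain ⟨h₁, h₂, -, -⟩ := orthogonal_four_twenty hA hΦ' hA'
  exact ⟨h₁, h₂⟩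

/-- `Y_8 ⟂ Y_{20}` at levels propositionally equal to `8` and `20`. [folklore] -/
private theorem orth_eight_twenty (hN : N = 8) (hN' : N' = 20) (hΦ : ∀ σ : K →+* ℂ, σ ∈ Φ.1 ↔ 2 * (expOf N K σ).val < N)
    (hA : IsCMTypeRealisation Φ A ι θ) (hΦ' : ∀ σ : K' →+* ℂ, σ ∈ Φ'.1 ↔ 2 * (expOf N' K' σ).val < N')
    (hA' : IsCMTypeRealisation Φ' A' ι' θ') : (∀ u : A ⟶ A', u = 0) ∧ ∀ u : A' ⟶ A, u = 0 := by
  subst hN hN'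
  obtain ⟨h₁, h₂, -, -⟩ := orthogonal_eight_twenty hΦ hA hΦ' hA'
  exact ⟨h₁, h₂⟩

/-- `X_d ⟂ X_4` (`d` odd `≥ 3`) at a level propositionally equal to `4`. [folklore] -/
private theorem orth_odd_four (hN' : N' = 4) (hodd : Odd N) (h3 : 3 ≤ N) (hΦ : ∀ σ : K →+* ℂ, σ ∈ Φ.1 ↔ 2 * (expOf N K σ).val < N)
    (hA : IsCMTypeRealisation Φ A ι θ) (hA' : IsCMTypeRealisation Φ' A' ι' θ') :
    (∀ u : A ⟶ A', u = 0) ∧ ∀ u : A' ⟶ A, u = 0 := by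
  subst hN'
  obtain ⟨h₁, h₂, -, -⟩ := orthogonal_odd_four hodd h3 hΦ hA hA'
  exact ⟨h₁, h₂⟩

/-- The simple isogeny factors of `X_4` are curves (level propositionally `4`). [folklore] -/
private theorem dim_eq_one_of_eq_four (hN : N = 4) (hA : IsCMTypeRealisation Φ A ι θ) {B : AbelianVariety ℂ}
    (hB : IsSimpleIsogenyFactor B A) : B.dim = 1 := by
  subst hN
  exact (dim_eq_one_of_isSimpleIsogenyFactor_four hA hB).2

/-- The simple isogeny factors of `X_{20}` are curves (level propositionally `20`). [folklore] -/
private theorem dim_eq_one_of_eq_twenty (hN : N = 20) (hΦ : ∀ σ : K →+* ℂ, σ ∈ Φ.1 ↔ 2 * (expOf N K σ).val < N)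
    (hA : IsCMTypeRealisation Φ A ι θ) {B : AbelianVariety ℂ} (hB : IsSimpleIsogenyFactor B A) : B.dim = 1 := by
  subst hN
  exact dim_eq_one_of_isSimpleIsogenyFactor_twenty hΦ hA hB

end Wrappers

section Family

variable {κ : Type} [Fintype κ] [DecidableEq κ] {lev : κ → ℕ} [∀ j, NeZero (lev j)] {F : κ → Type} [∀ j, Field (F j)]
  [∀ j, NumberField (F j)] [∀ j, IsCyclotomicExtension {lev j} ℚ (F j)] {Ψ : ∀ j, CMType (F j)} {C : κ → AbelianVariety ℂ}
  {ιC : ∀ j, 𝓞 (F j) →+* End (C j)} {θC : ∀ j, F j →+* Module.End ℂ (complexBetti (C j).X 1)}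

/-! ## §1 The dimension-count criterion -/

/-- **THE DIMENSION-COUNT CRITERION FOR STABLE DEGENERACY OF `J_m`.**  Let `(C_j)_j` be the Thm.-3.0 family of `J_m` (one member at each divisor
`e ≥ 3` of `m`) and `v : Fin r ↪ κ` some members such that every simple isogeny factor of `C_{v t}` has dimension `d_t`, two members with the same
`d_t` are orthogonal (`Hom(C_{v t}, C_{v t'}) = 0`), and `Σ_t d_t > φ(m)/2`.  Then `⨁_j C_j` is NOT stably nondegenerate.  PROOF: each `C_{v t}` is a
power of a simple `B_t ⊨ (K_t; Φ_t)` with `Φ_t^{ℚ(ζ)} = Ψ_{v t}` (Shimura–Taniyama), the `B_t` are pairwise non-isogenous (dimensions ∕ `Hom = 0`,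
Lange–Birkenhake 2.4.26), so the descended family is separating and Gordon 7.5 (1) ⟺ (3) reads `⨁_t C_{v t}` stably nondegenerate ⟺
`rank = Σ_t dim B_t + 1`; but `rank(Ψ ∘ v) ≤ rank(Ψ) = 1 + φ(m)/2 < Σ_t d_t + 1`, and `⨁_t C_{v t}` is a retract of `⨁_j C_j` (Hazama, Gordon 7.6.1).
[cite: Gordon1999HodgeAVSurvey, 7.4, 7.5 and 7.6.1] [cite: GalleseGoodsonLombardo2024, §3 Thm. 3.0 and §4.1 Prop. 19] [cite: Shimura1998, §6.2 Thm. 3 and §8.2 Prop. 26]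
[cite: Lange2023AbelianVarietiesComplex, Thm. 2.4.25 and Cor. 2.4.26] -/
theorem not_isStablyNondegenerate_biproduct_of_totient_div_two_lt_sum {m : ℕ} (hm : 3 ≤ m) (hlev : ∀ d, (∃ j, lev j = d) ↔ d ∣ m ∧ 3 ≤ d)
    (hΨ : ∀ j (σ : F j →+* ℂ), σ ∈ (Ψ j).1 ↔ 2 * (expOf (lev j) (F j) σ).val < lev j)
    (hC : ∀ j, IsCMTypeRealisation (Ψ j) (C j) (ιC j) (θC j)) {r : ℕ} {v : Fin r → κ} (hv : Function.Injective v) (d : Fin r → ℕ)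
    (hd : ∀ t (B : AbelianVariety ℂ), IsSimpleIsogenyFactor B (C (v t)) → B.dim = d t)
    (horth : ∀ t t', t ≠ t' → d t = d t' → ∀ u : C (v t) ⟶ C (v t'), u = 0) (hlt : m.totient / 2 < ∑ t, d t) :
    ¬IsStablyNondegenerate (⨁ C) := by
  classical
  rcases Nat.eq_zero_or_pos r with hr | hr
  · subst hr
    simp at hlt
  haveI : Nonempty (Fin r) := ⟨⟨0, hr⟩⟩
  intro hISN
  have h2 : ∀ j, 2 < lev j := fun j => by have := ((hlev (lev j)).1 ⟨j, rfl⟩).2; omega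
  haveI : ∀ j, IsCMField (F j) := fun j => IsCyclotomicExtension.Rat.isCMField (F j) (S := {lev j}) ⟨lev j, rfl, h2 j⟩
  choose K₁ Φ₁ B ιB θB hCM hind hB hs hISF using fun t : Fin r => exists_subpair_simpleIsogenyFactor (h2 (v t)) (hC (v t))
  haveI : ∀ t, IsCMField (K₁ t) := hCM
  have hdim : ∀ t, (B t).dim = d t := fun t => hd t (B t) (hISF t)
  have hniso : ∀ t t', t ≠ t' → ¬IsIsogenous (B t) (B t') := fun t t' htt' hiso => by
    have hdd : d t = d t' := by rw [← hdim, ← hdim]; exact hiso.dim_eq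
    obtain ⟨f, hf⟩ := exists_hom_ne_zero_of_isSimpleIsogenyFactor (hISF t) ((hISF t').of_isIsogenous_left hiso.symm')
    exact hf (horth t t' htt' hdd f)
  have hsub : IsStablyNondegenerate (⨁ fun t => C (v t)) := isStablyNondegenerate_biproduct_comp_of_injective C hv hISN
  have hrk : cmFamilyRank (fun t => Ψ (v t)) = (∑ t, (B t).dim) + 1 :=
    (isStablyNondegenerate_biproduct_iff_cmFamilyRank_eq_sum_dim_inducedCMType hB hs hniso
      (fun t => algebraMap (K₁ t) (F (v t))) hind (fun t => hC (v t))).1 hsub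
  have hle : cmFamilyRank (fun t => Ψ (v t)) ≤ cmFamilyRank Ψ := cmFamilyRank_comp_le Ψ v
  obtain ⟨j₀, -⟩ := (hlev m).2 ⟨dvd_rfl, hm⟩
  haveI : Nonempty κ := ⟨j₀⟩
  have hfull : cmFamilyRank Ψ = 1 + m.totient / 2 :=
    cmFamilyRank_eq_one_add_totient_div_two_of_conductorLevels hm (fun j => ((hlev (lev j)).1 ⟨j, rfl⟩).1)
      (fun e he h3 _ => (hlev e).2 ⟨he, h3⟩) Ψ hΨ
  have hsum : ∑ t, (B t).dim = ∑ t, d t := Finset.sum_congr rfl fun t _ => hdim t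
  omega

/-! ## §2 `J_{40}` and `J_{48}` -/

/-- **`J_{40}` IS NOT STABLY NONDEGENERATE**: its members of levels `4, 8, 20, 5, 40` have simple isogeny factors of dimensions `1, 1, 1, 2, 4` (`X_4`;
`X_8 ∼ Y_8²`; `X_{20} ∼ Y⁴`, GGL §3.4; `X_5`; `X_{40} ∼ Y_{40}²`, `dim Y_{40} = φ(40)/4`), `X_4 ⟂ Y_8`, `X_4 ⟂ Y_{20}`, `Y_8 ⟂ Y_{20}` (Thm. 3.0's last statement),
and `1 + 1 + 1 + 2 + 4 = 9 > 8 = φ(40)/2` (§1).  [cite: GalleseGoodsonLombardo2024, §3 Thm. 3.0 (3)–(6), its last statement, and §3.4]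
[cite: Gordon1999HodgeAVSurvey, 7.5 and 7.6.1] -/
theorem not_isStablyNondegenerate_biproduct_forty (hlev : ∀ d, (∃ j, lev j = d) ↔ d ∣ 40 ∧ 3 ≤ d)
    (hΨ : ∀ j (σ : F j →+* ℂ), σ ∈ (Ψ j).1 ↔ 2 * (expOf (lev j) (F j) σ).val < lev j)
    (hC : ∀ j, IsCMTypeRealisation (Ψ j) (C j) (ιC j) (θC j)) : ¬IsStablyNondegenerate (⨁ C) := by
  classical
  obtain ⟨j₄, hj₄⟩ := (hlev 4).2 ⟨by norm_num, by norm_num⟩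
  obtain ⟨j₈, hj₈⟩ := (hlev 8).2 ⟨by norm_num, by norm_num⟩
  obtain ⟨j₂₀, hj₂₀⟩ := (hlev 20).2 ⟨by norm_num, by norm_num⟩
  obtain ⟨j₅, hj₅⟩ := (hlev 5).2 ⟨by norm_num, by norm_num⟩
  obtain ⟨j₄₀, hj₄₀⟩ := (hlev 40).2 ⟨by norm_num, by norm_num⟩
  let v : Fin 5 → κ := ![j₄, j₈, j₂₀, j₅, j₄₀]
  have hv0 : lev (v 0) = 4 := hj₄
  have hv1 : lev (v 1) = 8 := hj₈
  have hv2 : lev (v 2) = 20 := hj₂₀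
  have hv3 : lev (v 3) = 5 := hj₅
  have hv4 : lev (v 4) = 40 := hj₄₀
  have hvinj : Function.Injective v := by
    intro a b hab
    have hl : lev (v a) = lev (v b) := congrArg lev hab
    fin_cases a <;> fin_cases b <;> first | rfl | (exfalso; simp [v] at hl; omega)
  -- the three orthogonality relations among the members with elliptic simple factors
  have o01 := orth_four_of_eight_dvd (N' := lev (v 1)) hv0 (hC (v 0)) (by rw [hv1]) (by rw [hv1]; norm_num) (hΨ (v 1)) (hC (v 1))
  have o02 := orth_four_twenty hv0 hv2 (hC (v 0)) (hΨ (v 2)) (hC (v 2))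
  have o12 := orth_eight_twenty hv1 hv2 (hΨ (v 1)) (hC (v 1)) (hΨ (v 2)) (hC (v 2))
  refine not_isStablyNondegenerate_biproduct_of_totient_div_two_lt_sum (by norm_num) hlev hΨ hC hvinj ![1, 1, 1, 2, 4] ?_ ?_ ?_
  · intro t B hB
    fin_cases t
    · exact dim_eq_one_of_eq_four hv0 (hC (v 0)) hB
    · have h := four_mul_dim_eq_totient_of_isSimpleIsogenyFactor_of_four_dvd (N := lev (v 1)) (by rw [hv1]; norm_num) (by rw [hv1])
        (by rw [hv1]; norm_num) (by rw [hv1]; norm_num) (by rw [hv1]; norm_num) (hΨ (v 1)) (hC (v 1)) hB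
      rw [hv1, show Nat.totient 8 = 4 by decide] at h
      show B.dim = 1
      omega
    · exact dim_eq_one_of_eq_twenty hv2 (hΨ (v 2)) (hC (v 2)) hB
    · have h := (two_mul_dim_eq_totient_of_isSimpleIsogenyFactor_of_not_four_dvd (N := lev (v 3)) (by rw [hv3]; norm_num)
        (by rw [hv3]; norm_num) (hΨ (v 3)) (hC (v 3)) hB).2
      rw [hv3, show Nat.totient 5 = 4 by decide] at h
      show B.dim = 2
      omega
    · have h := four_mul_dim_eq_totient_of_isSimpleIsogenyFactor_of_four_dvd (N := lev (v 4)) (by rw [hv4]; norm_num) (by rw [hv4]; norm_num)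
        (by rw [hv4]; norm_num) (by rw [hv4]; norm_num) (by rw [hv4]; norm_num) (hΨ (v 4)) (hC (v 4)) hB
      rw [hv4, show Nat.totient 40 = 16 by decide +kernel] at h
      show B.dim = 4
      omega
  · intro t t' htt' hdd u
    fin_cases t <;> fin_cases t' <;>
      first
      | exact absurd rfl htt'
      | exact o01.1 u
      | exact o01.2 u
      | exact o02.1 u
      | exact o02.2 u
      | exact o12.1 u
      | exact o12.2 u
      | (exfalso; simp at hdd)
  · rw [Fin.sum_univ_five, show Nat.totient 40 = 16 by decide +kernel]
    simp

/-- **`J_{48}` IS NOT STABLY NONDEGENERATE**: its members of levels `3, 4, 8, 16, 48` have simple isogeny factors of dimensions `1, 1, 1, 2, 4` (`X_3`, `X_4`,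
`X_8 ∼ Y_8²`, `X_{16} ∼ Y_{16}²`, `X_{48} ∼ Y_{48}²` with `dim Y_d = φ(d)/4`), `X_3 ⟂ X_4`, `X_3 ⟂ X_8`, `X_4 ⟂ Y_8`, and `9 > 8 = φ(48)/2` (§1).
[cite: GalleseGoodsonLombardo2024, §3 Thm. 3.0 (3)–(5) and its last statement] [cite: Gordon1999HodgeAVSurvey, 7.5 and 7.6.1] -/
theorem not_isStablyNondegenerate_biproduct_fortyEight (hlev : ∀ d, (∃ j, lev j = d) ↔ d ∣ 48 ∧ 3 ≤ d)
    (hΨ : ∀ j (σ : F j →+* ℂ), σ ∈ (Ψ j).1 ↔ 2 * (expOf (lev j) (F j) σ).val < lev j)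
    (hC : ∀ j, IsCMTypeRealisation (Ψ j) (C j) (ιC j) (θC j)) : ¬IsStablyNondegenerate (⨁ C) := by
  classical
  obtain ⟨j₃, hj₃⟩ := (hlev 3).2 ⟨by norm_num, by norm_num⟩
  obtain ⟨j₄, hj₄⟩ := (hlev 4).2 ⟨by norm_num, by norm_num⟩
  obtain ⟨j₈, hj₈⟩ := (hlev 8).2 ⟨by norm_num, by norm_num⟩
  obtain ⟨j₁₆, hj₁₆⟩ := (hlev 16).2 ⟨by norm_num, by norm_num⟩
  obtain ⟨j₄₈, hj₄₈⟩ := (hlev 48).2 ⟨by norm_num, by norm_num⟩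
  let v : Fin 5 → κ := ![j₃, j₄, j₈, j₁₆, j₄₈]
  have hv0 : lev (v 0) = 3 := hj₃
  have hv1 : lev (v 1) = 4 := hj₄
  have hv2 : lev (v 2) = 8 := hj₈
  have hv3 : lev (v 3) = 16 := hj₁₆
  have hv4 : lev (v 4) = 48 := hj₄₈
  have hvinj : Function.Injective v := by
    intro a b hab
    have hl : lev (v a) = lev (v b) := congrArg lev hab
    fin_cases a <;> fin_cases b <;> first | rfl | (exfalso; simp [v] at hl; omega)
  have o01 := orth_odd_four (N := lev (v 0)) hv1 (by rw [hv0]; decide) (by rw [hv0]) (hΨ (v 0)) (hC (v 0)) (hC (v 1))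
  have o02 : (∀ u : C (v 0) ⟶ C (v 2), u = 0) ∧ ∀ u : C (v 2) ⟶ C (v 0), u = 0 := by
    obtain ⟨h₁, h₂, -, -⟩ := orthogonal_odd_fourDvd (d := lev (v 0)) (d' := lev (v 2)) (by rw [hv0]; decide) (by rw [hv0])
      (hΨ (v 0)) (hC (v 0)) (by rw [hv2]; norm_num) (by rw [hv2]) (by rw [hv2]; norm_num) (by rw [hv2]; norm_num) (by rw [hv2]; norm_num)
      (hΨ (v 2)) (hC (v 2))
    exact ⟨h₁, h₂⟩
  have o12 := orth_four_of_eight_dvd (N' := lev (v 2)) hv1 (hC (v 1)) (by rw [hv2]) (by rw [hv2]; norm_num) (hΨ (v 2)) (hC (v 2))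
  refine not_isStablyNondegenerate_biproduct_of_totient_div_two_lt_sum (by norm_num) hlev hΨ hC hvinj ![1, 1, 1, 2, 4] ?_ ?_ ?_
  · intro t B hB
    fin_cases t
    · have h := (two_mul_dim_eq_totient_of_isSimpleIsogenyFactor_of_not_four_dvd (N := lev (v 0)) (by rw [hv0])
        (by rw [hv0]; norm_num) (hΨ (v 0)) (hC (v 0)) hB).2
      rw [hv0, show Nat.totient 3 = 2 by decide] at h
      show B.dim = 1
      omega
    · exact dim_eq_one_of_eq_four hv1 (hC (v 1)) hB
    · have h := four_mul_dim_eq_totient_of_isSimpleIsogenyFactor_of_four_dvd (N := lev (v 2)) (by rw [hv2]; norm_num) (by rw [hv2])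
        (by rw [hv2]; norm_num) (by rw [hv2]; norm_num) (by rw [hv2]; norm_num) (hΨ (v 2)) (hC (v 2)) hB
      rw [hv2, show Nat.totient 8 = 4 by decide] at h
      show B.dim = 1
      omega
    · have h := four_mul_dim_eq_totient_of_isSimpleIsogenyFactor_of_four_dvd (N := lev (v 3)) (by rw [hv3]; norm_num) (by rw [hv3]; norm_num)
        (by rw [hv3]; norm_num) (by rw [hv3]; norm_num) (by rw [hv3]; norm_num) (hΨ (v 3)) (hC (v 3)) hB
      rw [hv3, show Nat.totient 16 = 8 by decide +kernel] at h
      show B.dim = 2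
      omega
    · have h := four_mul_dim_eq_totient_of_isSimpleIsogenyFactor_of_four_dvd (N := lev (v 4)) (by rw [hv4]; norm_num) (by rw [hv4]; norm_num)
        (by rw [hv4]; norm_num) (by rw [hv4]; norm_num) (by rw [hv4]; norm_num) (hΨ (v 4)) (hC (v 4)) hB
      rw [hv4, show Nat.totient 48 = 16 by decide +kernel] at h
      show B.dim = 4
      omega
  · intro t t' htt' hdd u
    fin_cases t <;> fin_cases t' <;>
      first
      | exact absurd rfl htt'
      | exact o01.1 u
      | exact o01.2 u
      | exact o02.1 u
      | exact o02.2 u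
      | exact o12.1 u
      | exact o12.2 u
      | (exfalso; simp at hdd)
  · rw [Fin.sum_univ_five, show Nat.totient 48 = 16 by decide +kernel]
    simp

omit [Fintype κ] [DecidableEq κ] [∀ j, NeZero (lev j)] in
/-- The members of the `J_m`-family at the divisors of `n ∣ m` form a `J_n`-family. [folklore] -/
private theorem hlev_subtype {m n : ℕ} (hnm : n ∣ m) (hlev : ∀ d, (∃ j, lev j = d) ↔ d ∣ m ∧ 3 ≤ d) (d : ℕ) :
    (∃ s : {j // lev j ∣ n}, lev s.1 = d) ↔ d ∣ n ∧ 3 ≤ d := by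
  constructor
  · rintro ⟨⟨j, hj⟩, rfl⟩
    exact ⟨hj, ((hlev (lev j)).1 ⟨j, rfl⟩).2⟩
  · rintro ⟨hdn, h3⟩
    obtain ⟨j, hj⟩ := (hlev d).2 ⟨dvd_trans hdn hnm, h3⟩
    exact ⟨⟨j, by rw [hj]; exact hdn⟩, hj⟩

/-- **`J_m` IS NOT STABLY NONDEGENERATE FOR EVERY `m` WITH `40 ∣ m`** (`m = 40, 80, 120, 160, …`; the `J_{40}`-sub-family is a retract).
[cite: GalleseGoodsonLombardo2024, §1 (p. 4) and §3 Thm. 3.0] [cite: Gordon1999HodgeAVSurvey, 7.5 and 7.6.1] -/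
theorem not_isStablyNondegenerate_of_isIsogenous_biproduct_of_forty_dvd {m : ℕ} (hm : 40 ∣ m)
    (hlev : ∀ d, (∃ j, lev j = d) ↔ d ∣ m ∧ 3 ≤ d) (hΨ : ∀ j (σ : F j →+* ℂ), σ ∈ (Ψ j).1 ↔ 2 * (expOf (lev j) (F j) σ).val < lev j)
    (hC : ∀ j, IsCMTypeRealisation (Ψ j) (C j) (ιC j) (θC j)) {X : AbelianVariety ℂ} (hX : IsIsogenous X (⨁ C)) :
    ¬IsStablyNondegenerate X := by
  classical
  intro h
  have hsub := isStablyNondegenerate_biproduct_comp_of_injective (ι := {j // lev j ∣ 40}) C Subtype.val_injective (h.of_isIsogenous' hX)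
  exact not_isStablyNondegenerate_biproduct_forty (lev := fun s : {j // lev j ∣ 40} => lev s.1) (F := fun s => F s.1) (Ψ := fun s => Ψ s.1)
    (C := fun s => C s.1) (ιC := fun s => ιC s.1) (θC := fun s => θC s.1) (hlev_subtype hm hlev) (fun s σ => hΨ s.1 σ) (fun s => hC s.1) hsub

/-- **`J_m` IS NOT STABLY NONDEGENERATE FOR EVERY `m` WITH `48 ∣ m`** (`m = 48, 96, 144, …`; the `J_{48}`-sub-family is a retract).
[cite: GalleseGoodsonLombardo2024, §1 (p. 4) and §3 Thm. 3.0] [cite: Gordon1999HodgeAVSurvey, 7.5 and 7.6.1] -/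
theorem not_isStablyNondegenerate_of_isIsogenous_biproduct_of_fortyEight_dvd {m : ℕ} (hm : 48 ∣ m)
    (hlev : ∀ d, (∃ j, lev j = d) ↔ d ∣ m ∧ 3 ≤ d) (hΨ : ∀ j (σ : F j →+* ℂ), σ ∈ (Ψ j).1 ↔ 2 * (expOf (lev j) (F j) σ).val < lev j)
    (hC : ∀ j, IsCMTypeRealisation (Ψ j) (C j) (ιC j) (θC j)) {X : AbelianVariety ℂ} (hX : IsIsogenous X (⨁ C)) :
    ¬IsStablyNondegenerate X := by
  classical
  intro h
  have hsub := isStablyNondegenerate_biproduct_comp_of_injective (ι := {j // lev j ∣ 48}) C Subtype.val_injective (h.of_isIsogenous' hX)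
  exact not_isStablyNondegenerate_biproduct_fortyEight (lev := fun s : {j // lev j ∣ 48} => lev s.1) (F := fun s => F s.1) (Ψ := fun s => Ψ s.1)
    (C := fun s => C s.1) (ιC := fun s => ιC s.1) (θC := fun s => θC s.1) (hlev_subtype hm hlev) (fun s σ => hΨ s.1 σ) (fun s => hC s.1) hsub

/-! ## §3 The classification -/

/-- **THE NEGATIVE HALF**: `J_m` (everything isogenous to `⨁_j C_j`) is NOT stably nondegenerate if `m` has an odd composite divisor, or `4p ∣ m` for a
prime `p ≥ 7`, or `40 ∣ m`, or `48 ∣ m`. [cite: Goodson2024DegeneracyFermat, Thm. 1.1] [cite: GalleseGoodsonLombardo2024, §1 (p. 4) and §3 Thm. 3.0]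
[cite: Gordon1999HodgeAVSurvey, 7.4–7.6.1] -/
theorem not_isStablyNondegenerate_of_isIsogenous_biproduct' {m : ℕ}
    (hm : (∃ d, d ∣ m ∧ Odd d ∧ ¬d.Prime ∧ 1 < d) ∨ (∃ p, p.Prime ∧ 7 ≤ p ∧ 4 * p ∣ m) ∨ 40 ∣ m ∨ 48 ∣ m)
    (hlev : ∀ e, (∃ j, lev j = e) ↔ e ∣ m ∧ 3 ≤ e) (hΨ : ∀ j (σ : F j →+* ℂ), σ ∈ (Ψ j).1 ↔ 2 * (expOf (lev j) (F j) σ).val < lev j)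
    (hC : ∀ j, IsCMTypeRealisation (Ψ j) (C j) (ιC j) (θC j)) {X : AbelianVariety ℂ} (hX : IsIsogenous X (⨁ C)) :
    ¬IsStablyNondegenerate X := by
  rcases hm with h | h | h | h
  · exact not_isStablyNondegenerate_of_isIsogenous_biproduct (Or.inl h) hlev hΨ hC hX
  · exact not_isStablyNondegenerate_of_isIsogenous_biproduct (Or.inr h) hlev hΨ hC hX
  · exact not_isStablyNondegenerate_of_isIsogenous_biproduct_of_forty_dvd h hlev hΨ hC hX
  · exact not_isStablyNondegenerate_of_isIsogenous_biproduct_of_fortyEight_dvd h hlev hΨ hC hX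

/-- **THE POSITIVE HALF, AS STABLE NONDEGENERACY**: for `m` an odd prime, `2p`, `2^k` (`k ≥ 2`), a divisor `≥ 3` of `24`, or `20`, everything isogenous to
`⨁_j C_j` is stably nondegenerate (F35 on every power `X^{N+1} ∼ ⨁_{(n, j)} C_j`; `B = D` on it, van Geemen §2.4–2.5).
[cite: GalleseGoodsonLombardo2024, §1 (Theorem; p. 5) and §3 Thm. 3.0] [cite: Gordon1999HodgeAVSurvey, 7.5, 7.6.1 and 10.10] [cite: MoonenZarhin1999LowDim, (3.9)] -/
theorem isStablyNondegenerate_of_isIsogenous_biproduct_of_stablyNondegenerateLevel {m : ℕ}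
    (hm : (m.Prime ∧ m ≠ 2) ∨ (∃ p, p.Prime ∧ p ≠ 2 ∧ m = 2 * p) ∨ (∃ k, 2 ≤ k ∧ m = 2 ^ k) ∨ (3 ≤ m ∧ m ∣ 24) ∨ m = 20)
    (hlev : ∀ d, (∃ j, lev j = d) ↔ d ∣ m ∧ 3 ≤ d) (hinj : Function.Injective lev)
    (hΨ : ∀ j (σ : F j →+* ℂ), σ ∈ (Ψ j).1 ↔ 2 * (expOf (lev j) (F j) σ).val < lev j)
    (hC : ∀ j, IsCMTypeRealisation (Ψ j) (C j) (ιC j) (θC j)) {X : AbelianVariety ℂ} (hX : IsIsogenous X (⨁ C)) :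
    IsStablyNondegenerate X := by
  classical
  intro N
  have hiso : IsIsogenous (X.powSucc N) (⨁ fun s : (_ : Fin (N + 1)) × κ => C s.2) :=
    (isIsogenous_powSucc hX N).trans
      ((isIsogenous_powSucc_biproduct (⨁ C) N).trans (isIsogenous_biproduct_biproduct_sigma fun (_ : Fin (N + 1)) (j : κ) => C j))
  have hH := hodge_of_isIsogenous_prod_of_stablyNondegenerateLevel' hm hlev hinj hΨ hC (fun s : (_ : Fin (N + 1)) × κ => s.2) hiso
  exact (isDivisorGenerated_iff_forall_hodgeClassSpan_le _).2 fun q => (hH.1 q).le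

/-- Every `m ≥ 3` is in the positive list or satisfies one of the four degeneracy conditions (`m = 2^a·n`, `n` odd: `n = 1`; `n` prime with
`a ≤ 1`, or `a = 2` and `n ∈ {3, 5}` resp. `n ≥ 7`, or `a ≥ 3` and `n = 3` (`a = 3`: `24`; `a ≥ 4`: `48 ∣ m`), `n = 5` (`40 ∣ m`), `n ≥ 7`; `n` composite).
[folklore] -/
private theorem levels_dichotomy {m : ℕ} (hm : 3 ≤ m) :
    ((m.Prime ∧ m ≠ 2) ∨ (∃ p, p.Prime ∧ p ≠ 2 ∧ m = 2 * p) ∨ (∃ k, 2 ≤ k ∧ m = 2 ^ k) ∨ (3 ≤ m ∧ m ∣ 24) ∨ m = 20) ∨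
      ((∃ d, d ∣ m ∧ Odd d ∧ ¬d.Prime ∧ 1 < d) ∨ (∃ p, p.Prime ∧ 7 ≤ p ∧ 4 * p ∣ m) ∨ 40 ∣ m ∨ 48 ∣ m) := by
  obtain ⟨a, n, hn, rfl⟩ := Nat.exists_eq_two_pow_mul_odd (n := m) (by omega)
  obtain ⟨c, rfl⟩ := hn
  by_cases h1 : c = 0
  · -- `m = 2^a`
    subst h1
    refine Or.inl (Or.inr (Or.inr (Or.inl ⟨a, ?_, by ring⟩)))
    rcases a with _ | _ | a
    · norm_num at hm
    · norm_num at hm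
    · omega
  by_cases hp : (2 * c + 1).Prime
  · have hn2 : 2 * c + 1 ≠ 2 := by omega
    rcases a with _ | _ | _ | a
    · exact Or.inl (Or.inl ⟨by simpa using hp, by simp⟩)
    · exact Or.inl (Or.inr (Or.inl ⟨2 * c + 1, hp, hn2, by ring⟩))
    · by_cases h3 : c = 1
      · subst h3; exact Or.inl (Or.inr (Or.inr (Or.inr (Or.inl ⟨by norm_num, by norm_num⟩))))
      by_cases h5 : c = 2
      · subst h5; exact Or.inl (Or.inr (Or.inr (Or.inr (Or.inr (by norm_num)))))
      exact Or.inr (Or.inr (Or.inl ⟨2 * c + 1, hp, by omega, ⟨1, by ring⟩⟩))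
    · by_cases h3 : c = 1
      · subst h3
        rcases a with _ | a
        · exact Or.inl (Or.inr (Or.inr (Or.inr (Or.inl ⟨by norm_num, by norm_num⟩))))
        · exact Or.inr (Or.inr (Or.inr (Or.inr ⟨2 ^ a, by ring⟩)))
      by_cases h5 : c = 2
      · subst h5; exact Or.inr (Or.inr (Or.inr (Or.inl ⟨2 ^ a, by ring⟩)))
      exact Or.inr (Or.inr (Or.inl ⟨2 * c + 1, hp, by omega, ⟨2 ^ (a + 1), by ring⟩⟩))
  · exact Or.inr (Or.inl ⟨2 * c + 1, Dvd.intro_left _ rfl, ⟨c, rfl⟩, hp, by omega⟩)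

/-- **THE CLASSIFICATION OF THE STABLY NONDEGENERATE `J_m` (`m ≥ 3`).**  For the Thm.-3.0 family `(C_j ⊨ (ℚ(ζ_{e_j}); Ψ_j))_j` of `J_m` (one member
at each divisor `e ≥ 3` of `m`, distinct levels) and any `X ∼ ⨁_j C_j`:
`X` is stably nondegenerate ⟺ `m` is an odd prime, or `m = 2p` with `p` an odd prime, or `m = 2^k` (`k ≥ 2`), or `m ∣ 24`, or `m = 20`.
(Equivalently, by `rank MT(J_m) = 1 + φ(m)/2`: iff the simple isogeny classes of `J_m` have total dimension `φ(m)/2`.)  ASSEMBLED from GGL Thm. 3.0, the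
Theorem of §1 (Kubota ∕ Hazama), Goodson's Thm. 1.1, Gordon 7.4–7.6.1 and the tree's rank formula; not printed as one statement.
[cite: GalleseGoodsonLombardo2024, §1 (pp. 4–5) and §3 Thm. 3.0] [cite: Goodson2024DegeneracyFermat, Thm. 1.1] [cite: Gordon1999HodgeAVSurvey, 7.4–7.6.1]
[cite: Kubota1965, §4 Lemma 2] -/
theorem isStablyNondegenerate_iff_of_isIsogenous_biproduct {m : ℕ} (hm : 3 ≤ m) (hlev : ∀ d, (∃ j, lev j = d) ↔ d ∣ m ∧ 3 ≤ d)
    (hinj : Function.Injective lev) (hΨ : ∀ j (σ : F j →+* ℂ), σ ∈ (Ψ j).1 ↔ 2 * (expOf (lev j) (F j) σ).val < lev j)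
    (hC : ∀ j, IsCMTypeRealisation (Ψ j) (C j) (ιC j) (θC j)) {X : AbelianVariety ℂ} (hX : IsIsogenous X (⨁ C)) :
    IsStablyNondegenerate X ↔
      (m.Prime ∧ m ≠ 2) ∨ (∃ p, p.Prime ∧ p ≠ 2 ∧ m = 2 * p) ∨ (∃ k, 2 ≤ k ∧ m = 2 ^ k) ∨ (3 ≤ m ∧ m ∣ 24) ∨ m = 20 := by
  refine ⟨fun h => ?_, fun h => isStablyNondegenerate_of_isIsogenous_biproduct_of_stablyNondegenerateLevel h hlev hinj hΨ hC hX⟩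
  rcases levels_dichotomy hm with hpos | hneg
  · exact hpos
  · exact absurd h (not_isStablyNondegenerate_of_isIsogenous_biproduct' hneg hlev hΨ hC hX)

/-- **THE CLASSIFICATION, ON `J_m` ITSELF** (the biproduct `⨁_j C_j`). [cite: GalleseGoodsonLombardo2024, §1 (pp. 4–5) and §3 Thm. 3.0]
[cite: Goodson2024DegeneracyFermat, Thm. 1.1] [cite: Gordon1999HodgeAVSurvey, 7.4–7.6.1] -/
theorem isStablyNondegenerate_biproduct_iff {m : ℕ} (hm : 3 ≤ m) (hlev : ∀ d, (∃ j, lev j = d) ↔ d ∣ m ∧ 3 ≤ d)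
    (hinj : Function.Injective lev) (hΨ : ∀ j (σ : F j →+* ℂ), σ ∈ (Ψ j).1 ↔ 2 * (expOf (lev j) (F j) σ).val < lev j)
    (hC : ∀ j, IsCMTypeRealisation (Ψ j) (C j) (ιC j) (θC j)) :
    IsStablyNondegenerate (⨁ C) ↔
      (m.Prime ∧ m ≠ 2) ∨ (∃ p, p.Prime ∧ p ≠ 2 ∧ m = 2 * p) ∨ (∃ k, 2 ≤ k ∧ m = 2 ^ k) ∨ (3 ≤ m ∧ m ∣ 24) ∨ m = 20 :=
  isStablyNondegenerate_iff_of_isIsogenous_biproduct hm hlev hinj hΨ hC (IsIsogenous.refl _)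

end Family

end HyperellipticJacobian

end Literature.AlgebraicGeometry.ComplexMultiplication

end
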